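import Literature.Geometry.Lorentzian.KerrDerivativeDecayHierarchy
import Literature.Geometry.Lorentzian.KerrLeafCoercivity
import HarnessLib

/-!
# DRSR Corollary 3.1 (31) on subextremal Kerr (`drsr_wave_derivative_decay_kerr`): decomposition
# of the named fact along the improved-decay hierarchy (fact-decompose, 2026-08-16)

(statement group **gr.S24**; namespace `Literature.Geometry.Lorentzian.Kerr`, glue in
`Literature.Geometry.Lorentzian`)

M. Dafermos, I. Rodnianski, Y. Shlapentokh-Rothman, *Decay for solutions of the wave equation on
Kerr exterior spacetimes III*, arXiv:1402.7034 = Ann. of Math. 183 (2016) ("DRSR"), §3.3,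
Cor. 3.1, estimate (31): `sup_{Σ̃_τ ∩ {r ≤ R}} |n_Σ̃ ψ| + |∇_Σ̃ ψ| ≤ C E τ^{-2+δ}`, vendored in
coordinate form as the named fact `Literature.Geometry.Lorentzian.drsr_wave_derivative_decay_kerr`
(`KerrWaveDecay.lean`). In print Cor. 3.1 follows from Thms. 3.1–3.2 transferred to hypersurfaces
terminating at `𝓘⁺` and the `r^p` "black box" of Dafermos–Rodnianski (arXiv:0910.4957), with
pointwise bounds by commutation and Sobolev inequalities (DRSR p. 14; Moschidis,
arXiv:1509.08489, §1.3.3, Thms. 7.1, 8.1, 9.1, Cor. 9.2). The tree PROVES that assembly on its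
concrete objects (the foliation `Σ̃_τ(h♯_{R₁})` of `KerrHyperboloidalFlux.lean`):

* `drsr_corollary_3_1_scri_flux_decay_of_hierarchy` (`KerrDecayHierarchy.lean`): the first
  estimate of Cor. 3.1 (flux `≤ C τ⁻²`) from fact A `Kerr.drsr_theorems_3_1_3_2_scri` (Thms.
  3.1–3.2 in §3.3 form) and fact B `Kerr.dafermosRodnianski_pHierarchy_scri` (the `r^p`
  hierarchy, `p = 1, 2`), both existing named facts;
* `leafGradEnergy_decay_of_flux_decay` (`KerrLeafCoercivity.lean`): hence (D1), the decay
  `τ⁻²` of the first-order Cartesian leaf energy;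
* `drsr_wave_derivative_decay_kerr_of_leafEnergy_decay` (`KerrDerivativeDecayHierarchy.lean`):
  (31) in coordinate form from (D) = (D1) ∧ (D2) ∧ (D3) and (D′) = (D4) ∧ (D5) (the Agmon /
  Gagliardo–Nirenberg inequality on the leaves being the theorem `Kerr.gagliardoNirenberg_slice`),

leaving as the only inputs beyond A and B the higher-order members of the improved-decay
hierarchy, written in those files as plain binders (D-0026): (D2) second-order leaf energy
`≤ C_δ τ^{-4+2δ}`, (D3) a priori decay `‖y‖|Ψ_τ|, ‖y‖‖DΨ_τ‖ ≤ C₀` along each leaf, (D4)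
third-order leaf energy `≤ C_δ τ^{-4+2δ}`, (D5) `‖y‖‖D²Ψ_τ‖ ≤ C₀`. The proving seat hit the budget
cap on facts A/B themselves. This file turns the two binders into named facts and records the
four-input assembly:

* `Kerr.drsr_corollary_3_1_scri_secondOrder_decay` — **(D2) ∧ (D3)** (child): the second
  estimate of Cor. 3.1, `∫_{Σ̃_τ ∩ {r ≤ R}} J^N[Nψ] n ≤ C E τ^{-4+2δ}` with the elliptic estimate
  (29) — Moschidis Thm. 9.1 (`d = 3`, `q = 2`, `m = 0`) — and the radiation-field a priori decay
  (third estimate of Cor. 3.1; Moschidis Thm. 7.1), in the Cartesian leaf rendering of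
  `KerrPointwiseDecayHierarchy.lean` (rendering notes (a)–(d) there);
* `Kerr.drsr_corollary_3_1_scri_thirdOrder_decay` — **(D4) ∧ (D5)** (child): the same one
  order up (Moschidis Thm. 9.1 with `m = 1`; Cor. 3.1 second estimate commuted with `T`, `N`,
  `Ω̃` and (29); Thm. 7.1 for the second tangential derivatives), as documented in the module
  docstring of `KerrDerivativeDecayHierarchy.lean` (*The energy-level hypotheses (D′)*);
* `drsr_wave_derivative_decay_kerr_holds_of` — **the assembly**
  `A → B → (D2 ∧ D3) → (D4 ∧ D5) → drsr_wave_derivative_decay_kerr` (proved).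

Both children are whole-leaf `L²` / a priori statements of the printed hierarchy at orders two and
three — different statements from the pointwise first-order bound of the parent; they are the
interface "a literature seat vendoring Moschidis Thm. 9.1 (`q = 2`, `m ≤ 1`) and Thm. 7.1 on Kerr
in this Cartesian form closes both by `exact`" announced in `KerrDerivativeDecayHierarchy.lean`.

## References

* M. Dafermos, I. Rodnianski, Y. Shlapentokh-Rothman, Ann. of Math. 183 (2016) 787–913,
  arXiv:1402.7034: §3.3 Cor. 3.1 (30)–(31), p. 14 (the black box), p. 51
  (key `DafermosRodnianskiShlapentokhrothman2014`).
* G. Moschidis, *The `r^p`-weighted energy method of Dafermos and Rodnianski in general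
  asymptotically flat spacetimes and applications*, Ann. PDE 2 (2016), arXiv:1509.08489: §1.3.3,
  Thm. 7.1, §9.2, Thm. 9.1, Cor. 9.2 (key `Moschidis2016`).
* M. Dafermos, I. Rodnianski, arXiv:0910.4957, §5 (key `DafermosRodnianski2010ICMP`).
-/

noncomputable section

open Set Filter MeasureTheory Metric TopologicalSpace
open scoped Topology ENNReal Manifold ContDiff

namespace Literature.Geometry.Lorentzian

namespace Kerr

/-- **DRSR Cor. 3.1, second and third estimates, order two, through `Σ̃_τ(h♯_{R₁})` — hypotheses
(D2) ∧ (D3) of the (30)/(31)-assemblies as a named fact.** For `|a| < M` there is `R₀ > r₊` such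
that for every `R₁ ≥ R₀` and every admissible wave `ψ` (`IsAdmissibleKerrWave`) with ball data of
radius `R₁` (`HasBallData`): (D2) for every `δ > 0` some `C` bounds the second-order Cartesian
leaf energy `leafHessEnergy M a (scriHeight M a R₁) ψ τ = ∫_S ‖D²Ψ_τ‖² dy` by `C τ^{-4+2δ}` for all
`τ ≥ 1` — on Kerr the second estimate of DRSR Cor. 3.1, `∫_{Σ̃_τ∩{r≤R}} J^N[Nψ] n ≤ C E τ^{-4+2δ}`
with the elliptic estimate (29) of Thm. 3.2 transferred to `Σ̃_τ` (§3.3), i.e. Moschidis Thm. 9.1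
(`d = 3`, `q = 2`, `F = 0`) for subextremal Kerr (his §1.3.3); (D3) on each leaf `τ ≥ 1` the
radiation-field quantities `‖y‖ |Ψ_τ(y)|` and `‖y‖ ‖DΨ_τ(y)‖` are bounded on the slice region
`S = {r(0,·) > r₊}` (third estimate of Cor. 3.1, `sup r|ψ − ψ_∞| ≤ C √E τ^{-1/2}` with `ψ_∞ = 0`;
Moschidis Thm. 7.1, existence of the radiation field with its tangential derivative). Here
`Ψ_τ = leafFun M a (scriHeight M a R₁) ψ τ` is the leaf function along the hyperboloidal foliation
`Σ̃_τ(h♯_{R₁}) = {t*_KS = τ + h♯_{R₁}(y)}` of `KerrHyperboloidalFlux.lean`; the Cartesian rendering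
(`h_{τ,N} ≃ δ`, `dh_N ≃ dy`, `N ↦ T`, covariant versus coordinate derivatives) is that of
`KerrPointwiseDecayHierarchy.lean`, (a)–(d), with the Hardy/Kato remark of
`KerrDerivativeDecayHierarchy.lean`. The statement asserts less than the sources (existential
`ψ`-dependent constants, one foliation, compactly supported data).
[cite: DafermosRodnianskiShlapentokhrothman2014, §3.3 Cor. 3.1 (second and third estimates) with Thm. 3.2 (29)]
[cite: Moschidis2016, Thm. 9.1 (q = 2) and Thm. 7.1, §1.3.3] -/
def drsr_corollary_3_1_scri_secondOrder_decay : Prop :=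
  ∀ [Facts] [SliceFacts] (M a : ℝ), IsSubextremal M a →
    ∃ R₀ : ℝ, rPlus M a < R₀ ∧ ∀ R₁ : ℝ, R₀ ≤ R₁ →
      ∀ ψ : region a (rPlus M a) → ℝ, Literature.Geometry.Lorentzian.IsAdmissibleKerrWave M a ψ →
        HasBallData M a R₁ ψ →
          (∀ δ : ℝ, 0 < δ → ∃ C : ℝ, ∀ τ : ℝ, 1 ≤ τ →
            leafHessEnergy M a (scriHeight M a R₁) ψ τ ≤
              ENNReal.ofReal (C * τ ^ (-4 + 2 * δ))) ∧
          (∀ τ : ℝ, 1 ≤ τ → ∃ C₀ : ℝ, ∀ y ∈ (slice a (rPlus M a) : Set E3),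
            ‖y‖ * |leafFun M a (scriHeight M a R₁) ψ τ y| ≤ C₀ ∧
              ‖y‖ * ‖fderiv ℝ (leafFun M a (scriHeight M a R₁) ψ τ) y‖ ≤ C₀)

/-- **The improved-decay hierarchy one order up — hypotheses (D4) ∧ (D5) of the (31)-assembly as
a named fact.** For `|a| < M` there is `R₀ > r₊` such that for every `R₁ ≥ R₀` and every
admissible wave `ψ` with ball data of radius `R₁`: (D4) for every `δ > 0` some `C` bounds the
third-order Cartesian leaf energy `∫_S ‖D³Ψ_τ‖² dy` (`iteratedFDeriv ℝ 3` of the leaf function)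
by `C τ^{-4+2δ}` for `τ ≥ 1` — Moschidis Thm. 9.1 with `d = 3`, `q = 2`, `m = 1` (the
`(j₂, j₃) = (2, 0)`, `j = 1` member of `𝓔_en^{(0,2,1)}`, §9.2), on Kerr the second estimate of
DRSR Cor. 3.1 commuted with `T`, `N`, `Ω̃` together with the elliptic estimate (29) (DRSR p. 14:
"apply the black box … see [Moschidis] for detailed treatments"); (D5) on each leaf `τ ≥ 1`,
`‖y‖ ‖D²Ψ_τ(y)‖` is bounded on `S` (smoothness up to `𝓗⁺` on the compact part; Moschidis Thm.
7.1 far out: the radiation field with its tangential derivatives). Rendering as for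
`drsr_corollary_3_1_scri_secondOrder_decay`; documented in the module docstring of
`KerrDerivativeDecayHierarchy.lean`, *The energy-level hypotheses (D′) and their derivation from
print*. The statement asserts less than the sources.
[cite: Moschidis2016, Thm. 9.1 (q = 2, m = 1) with §9.2, Thm. 7.1, §1.3.3]
[cite: DafermosRodnianskiShlapentokhrothman2014, §3.3 Cor. 3.1 (second estimate, commuted) with Thm. 3.2 (29), p. 14] -/
def drsr_corollary_3_1_scri_thirdOrder_decay : Prop :=
  ∀ [Facts] [SliceFacts] (M a : ℝ), IsSubextremal M a →
    ∃ R₀ : ℝ, rPlus M a < R₀ ∧ ∀ R₁ : ℝ, R₀ ≤ R₁ →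
      ∀ ψ : region a (rPlus M a) → ℝ, Literature.Geometry.Lorentzian.IsAdmissibleKerrWave M a ψ →
        HasBallData M a R₁ ψ →
          (∀ δ : ℝ, 0 < δ → ∃ C : ℝ, ∀ τ : ℝ, 1 ≤ τ →
            (∫⁻ y in (slice a (rPlus M a) : Set E3), ENNReal.ofReal
                (‖iteratedFDeriv ℝ 3 (leafFun M a (scriHeight M a R₁) ψ τ) y‖ ^ 2)) ≤
              ENNReal.ofReal (C * τ ^ (-4 + 2 * δ))) ∧
          (∀ τ : ℝ, 1 ≤ τ → ∃ C₀ : ℝ, ∀ y ∈ (slice a (rPlus M a) : Set E3),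
            ‖y‖ * ‖fderiv ℝ (fderiv ℝ (leafFun M a (scriHeight M a R₁) ψ τ)) y‖ ≤ C₀)

/-- **Assembly of DRSR Cor. 3.1 (31) in coordinate form from the hierarchy**: the gr.S24 named fact
`Literature.Geometry.Lorentzian.drsr_wave_derivative_decay_kerr` follows from fact A
(`Kerr.drsr_theorems_3_1_3_2_scri`, DRSR Thms. 3.1–3.2 in §3.3 form), fact B
(`Kerr.dafermosRodnianski_pHierarchy_scri`, the `r^p` hierarchy) and the two children
`Kerr.drsr_corollary_3_1_scri_secondOrder_decay`, `Kerr.drsr_corollary_3_1_scri_thirdOrder_decay`: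
(D1) comes from A and B through `drsr_corollary_3_1_scri_flux_decay_of_hierarchy` and
`leafGradEnergy_decay_of_flux_decay`, and `drsr_wave_derivative_decay_kerr_of_leafEnergy_decay`
does the rest (Gagliardo–Nirenberg on the leaves, proved). The discharge
`drsr_wave_derivative_decay_kerr_holds` is this theorem applied to the four `…_holds` once they
land. [cite: DafermosRodnianskiShlapentokhrothman2014, §3.3 Cor. 3.1 (31), p. 14 and p. 51]
[cite: Moschidis2016, Cor. 9.2 with §9.9] -/
theorem _root_.Literature.Geometry.Lorentzian.drsr_wave_derivative_decay_kerr_holds_of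
    (hA : drsr_theorems_3_1_3_2_scri) (hB : dafermosRodnianski_pHierarchy_scri)
    (h₂ : drsr_corollary_3_1_scri_secondOrder_decay)
    (h₃ : drsr_corollary_3_1_scri_thirdOrder_decay) :
    drsr_wave_derivative_decay_kerr := by
  refine drsr_wave_derivative_decay_kerr_of_leafEnergy_decay ?_ h₃
  intro _ _ M a hMa
  obtain ⟨R₁', h₁, hD1⟩ :=
    leafGradEnergy_decay_of_flux_decay (drsr_corollary_3_1_scri_flux_decay_of_hierarchy hA hB)
      M a hMa
  obtain ⟨R₂, h₂', hD23⟩ := h₂ M a hMa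
  refine ⟨max R₁' R₂, lt_max_of_lt_left h₁, fun R₁ hR₁ ψ hψ hball ↦ ⟨?_, ?_⟩⟩
  · exact hD1 R₁ ((le_max_left _ _).trans hR₁) ψ hψ hball
  · exact hD23 R₁ ((le_max_right _ _).trans hR₁) ψ hψ hball

/-- **Assembly of DRSR Cor. 3.1 (30) in coordinate form from the hierarchy**: the companion gr.S24
named fact `Literature.Geometry.Lorentzian.drsr_wave_pointwise_decay_kerr` (`KerrWaveDecay.lean`;
`|ψ| ≤ C τ^{-3/2+δ}` on `{t* = τ} ∩ {r > r₊} ∩ {‖y‖ ≤ R}`) follows from fact A, fact B and the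
FIRST child alone (`Kerr.drsr_corollary_3_1_scri_secondOrder_decay` = (D2) ∧ (D3)) — the tree's
theorem `drsr_wave_pointwise_decay_kerr_of_hierarchy` (`KerrLeafCoercivity.lean`: flux decay from
A ∧ B, (D1) by coercivity, Agmon's inequality on the leaves). So the two children of this file
decompose both pointwise statements of Cor. 3.1.
[cite: DafermosRodnianskiShlapentokhrothman2014, §3.3 Cor. 3.1 (30)] [cite: Moschidis2016, §9.4] -/
theorem _root_.Literature.Geometry.Lorentzian.drsr_wave_pointwise_decay_kerr_holds_of
    (hA : drsr_theorems_3_1_3_2_scri) (hB : dafermosRodnianski_pHierarchy_scri)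
    (h₂ : drsr_corollary_3_1_scri_secondOrder_decay) :
    drsr_wave_pointwise_decay_kerr :=
  drsr_wave_pointwise_decay_kerr_of_hierarchy hA hB h₂

end Kerr

end Literature.Geometry.Lorentzian

end
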